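import Mathlib.Data.Fintype.Basic
import Mathlib.Data.Fintype.Card
import Mathlib.Order.Lattice.Nat
import Mathlib.Order.ConditionallyCompleteLattice.Basic
import HarnessLib

-- provenance: harness21/H21/H21/Prelude/CplxCore/Circuit.lean @ 12e2ffd (interim HEAD d8f2665); M5 mechanical rewrite
/-!
# Boolean circuits as straight-line programs (trunk CplxCore, item C13 / design D5)

A Boolean circuit over input variables `ι` is modelled as a *straight-line program*: a list of
gates, each carrying its arity `k`, its truth table `(Fin k → Bool) → Bool` and its argument
wires, where a wire is either an input variable (`Sum.inl i`) or a back-reference to an earlier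
gate (`Sum.inr m`, `m < j` for the `j`-th gate). Well-formedness (acyclicity, valid output) is
bundled as proof fields, so every `Circuit ι` evaluates without junk. A *basis* is a
`Set GateFn` where `GateFn := Σ k, (Fin k → Bool) → Bool`; size is the number of gates, depth the
longest (weighted) path to the output.

Sources: S. Arora, B. Barak, *Computational Complexity: A Modern Approach* (2009), Def. 6.1
(circuits as DAGs / straight-line programs), §14.1–14.4 (AC⁰, ACC⁰, monotone circuits);
H. Vollmer, *Introduction to Circuit Complexity* (1999), §1.1–1.2 (bases, size, depth, MOD, MAJ,
threshold gates); S. Jukna, *Boolean Function Complexity* (2012), §1.2 (De Morgan / monotone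
basis, formulas).

Mathlib has no Boolean circuits (searched: only `Matroid.IsCircuit`, `SimpleGraph.Walk.IsCircuit`
are unrelated); everything here is new, in `namespace Literature.CplxCore`.

Design choices:
* Single output wire. Multi-output circuits are not needed by the target statements.
* `circuitSizeOver B f` and `formulaSizeOver B f` are `sInf`s over `ℕ`, hence take the **junk
  value `0`** when no circuit over `B` computes `f`. Over `monotoneBasis = {∧₂, ∨₂}` (no
  constants, no negation) this happens for every non-monotone `f` and for the constant functions;
  over `deMorganBasis`/`B2` with `[Fintype ι] [Nonempty ι]` every `f` is computed by some circuit
  (`exists_computes_deMorgan`), so the infimum is attained (review F13c).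
* `GateFn.modGate m k` outputs `true` iff the number of ones is **not** divisible by `m`
  (Arora–Barak Def. 14.3; Vollmer uses the complementary convention — both give the same ACC⁰).
* `GateFn.maj k` outputs `true` iff at least half of the inputs are one (`k ≤ 2 * #ones`,
  Vollmer Def. 1.9).
-/

namespace Literature.Computability.Complexity

open Finset

/-! ### Gate functions and bases -/

/-- A *gate function*: an arity `k` together with a truth table `(Fin k → Bool) → Bool`.
A basis of gates is a `Set GateFn` (Vollmer 1999, §1.1). [cite: Vollmer1999, §1.1] -/
abbrev GateFn : Type := Σ k : ℕ, ((Fin k → Bool) → Bool)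

namespace GateFn

/-- The number of inputs set to `true` in an assignment `v : Fin k → Bool`
(auxiliary for symmetric gates; Vollmer 1999, §1.1). [cite: Vollmer1999, §1.1] -/
def numOnes {k : ℕ} (v : Fin k → Bool) : ℕ := (univ.filter fun i => v i = true).card

/-- The `k`-ary conjunction gate `∧ₖ` (Vollmer 1999, §1.1). For `k = 0` it is the constant
`true`. [cite: Vollmer1999, §1.1] -/
def and (k : ℕ) : GateFn := ⟨k, fun v => decide (∀ i, v i = true)⟩

/-- The `k`-ary disjunction gate `∨ₖ` (Vollmer 1999, §1.1). For `k = 0` it is the constant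
`false`. [cite: Vollmer1999, §1.1] -/
def or (k : ℕ) : GateFn := ⟨k, fun v => decide (∃ i, v i = true)⟩

/-- The negation gate `¬` (arity 1) (Vollmer 1999, §1.1). [cite: Vollmer1999, §1.1] -/
def not : GateFn := ⟨1, fun v => !(v 0)⟩

/-- The identity gate (arity 1) (Vollmer 1999, §1.1). [cite: Vollmer1999, §1.1] -/
def id : GateFn := ⟨1, fun v => v 0⟩

/-- The `k`-ary parity gate `⊕ₖ`: `true` iff an odd number of inputs are `true`
(Vollmer 1999, §1.1). [cite: Vollmer1999, §1.1] -/
def xor (k : ℕ) : GateFn := ⟨k, fun v => decide (numOnes v % 2 = 1)⟩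

/-- The `k`-ary modular counting gate `MODₘ`: outputs `true` iff the number of `true` inputs is
**not** divisible by `m` (Arora–Barak 2009, Def. 14.3). Vollmer's `MODₘ` is the complement; both
conventions generate the same class ACC⁰. For `m = 0`, `n % 0 = n`, so the gate is `∨ₖ`. [cite: AroraBarak2009, Def. 14.3] -/
def modGate (m k : ℕ) : GateFn := ⟨k, fun v => decide (numOnes v % m ≠ 0)⟩

/-- The `k`-ary majority gate `MAJₖ`: `true` iff at least half of the inputs are `true`, i.e.
`k ≤ 2 * #ones` (Vollmer 1999, Def. 1.9). [cite: Vollmer1999, Def. 1.9] -/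
def maj (k : ℕ) : GateFn := ⟨k, fun v => decide (k ≤ 2 * numOnes v)⟩

/-- The `k`-ary threshold gate `Tₜᵏ`: `true` iff at least `t` inputs are `true`
(Vollmer 1999, §1.1). [cite: Vollmer1999, §1.1] -/
def thr (k t : ℕ) : GateFn := ⟨k, fun v => decide (t ≤ numOnes v)⟩

/-- The constant gate (arity 0) with value `b` (Vollmer 1999, §1.1). [cite: Vollmer1999, §1.1] -/
def const (b : Bool) : GateFn := ⟨0, fun _ => b⟩

end GateFn

/-- The basis `B₂` of all gates of fan-in at most `2` (Jukna 2012, §1.2; Vollmer 1999, §1.1). [cite: Jukna2012, §1.2] -/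
def B2 : Set GateFn := {f | f.1 ≤ 2}

/-- The De Morgan basis `{∧₂, ∨₂, ¬}` (Jukna 2012, §1.2). It contains no constant gates; over a
nonempty finite set of variables constants are nevertheless computable (`x ∧ ¬x`). [cite: Jukna2012, §1.2] -/
def deMorganBasis : Set GateFn := {GateFn.and 2, GateFn.or 2, GateFn.not}

/-- The monotone basis `{∧₂, ∨₂}` (Jukna 2012, §1.2; Arora–Barak 2009, §14.3). Circuits over it
compute exactly the non-constant monotone Boolean functions (no constants are available). [cite: Jukna2012, §1.2] -/
def monotoneBasis : Set GateFn := {GateFn.and 2, GateFn.or 2}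

/-- The full basis: all gate functions of all arities (Vollmer 1999, §1.1, "unbounded fan-in"). [cite: Vollmer1999, §1.1  "unbounded fan-in"] -/
def fullBasis : Set GateFn := Set.univ

/-- `{∧₂, ∨₂} ⊆ {∧₂, ∨₂, ¬}` (Jukna 2012, §1.2). [cite: Jukna2012, §1.2] -/
theorem monotoneBasis_subset_deMorgan : monotoneBasis ⊆ deMorganBasis := by
  intro f hf
  simp only [monotoneBasis, Set.mem_insert_iff, Set.mem_singleton_iff] at hf
  simp only [deMorganBasis, Set.mem_insert_iff, Set.mem_singleton_iff]
  tauto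

/-- `{∧₂, ∨₂, ¬} ⊆ B₂` (Jukna 2012, §1.2). [cite: Jukna2012, §1.2] -/
theorem deMorganBasis_subset_B2 : deMorganBasis ⊆ B2 := by
  intro f hf
  simp only [deMorganBasis, Set.mem_insert_iff, Set.mem_singleton_iff] at hf
  rcases hf with rfl | rfl | rfl <;> simp [B2, GateFn.and, GateFn.or, GateFn.not]

/-! ### Gates and circuits -/

/-- A gate of a straight-line program over input variables `ι`: an arity, a truth table, and for
each argument position a wire, which is either an input variable `Sum.inl i` or a back-reference
`Sum.inr m` to the `m`-th gate (Arora–Barak 2009, Def. 6.1 and Rem. 6.4). [cite: AroraBarak2009, Def. 6.1 and Rem. 6.4] -/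
structure Gate (ι : Type*) where
  /-- The fan-in of the gate. -/
  arity : ℕ
  /-- The Boolean function computed by the gate. -/
  op : (Fin arity → Bool) → Bool
  /-- The wires feeding the gate: inputs `inl i` or earlier gates `inr m`. -/
  args : Fin arity → ι ⊕ ℕ

/-- The gate function (arity and truth table) of a gate, forgetting its wiring
(Vollmer 1999, §1.1). [cite: Vollmer1999, §1.1] -/
def Gate.fn {ι : Type*} (g : Gate ι) : GateFn := ⟨g.arity, g.op⟩

/-- A Boolean circuit over input variables `ι` with a single output, as a well-formed
straight-line program: gate `j` only refers to gates `m < j`, and the output wire refers to an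
input or to an existing gate (Arora–Barak 2009, Def. 6.1, Rem. 6.4; Vollmer 1999, Def. 1.6). [cite: AroraBarak2009, Def. 6.1  Rem. 6.4] -/
structure Circuit (ι : Type*) where
  /-- The gates, in topological order. -/
  gates : List (Gate ι)
  /-- The output wire. -/
  output : ι ⊕ ℕ
  /-- Acyclicity: gate `j` only reads gates `m < j`. -/
  wf : ∀ (j : ℕ) (h : j < gates.length) (a : Fin (gates[j]).arity) (m : ℕ),
    (gates[j]).args a = .inr m → m < j
  /-- The output wire, if a gate, is an existing gate. -/
  wf_output : ∀ m, output = .inr m → m < gates.length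

namespace Circuit

variable {ι : Type*}

/-- The list of values of all gates of `C` on input `x`, computed in program order
(Arora–Barak 2009, Rem. 6.4). Back-references out of range (impossible by `wf`) read `false`. [cite: AroraBarak2009, Rem. 6.4] -/
def wireVals (C : Circuit ι) (x : ι → Bool) : List Bool :=
  C.gates.foldl (fun vals g => vals ++
    [g.op fun a => match g.args a with
      | .inl i => x i
      | .inr m => vals.getD m false]) []

/-- The value computed by the circuit `C` on input `x` (Arora–Barak 2009, Def. 6.1). [cite: AroraBarak2009, Def. 6.1] -/
def eval (C : Circuit ι) (x : ι → Bool) : Bool :=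
  match C.output with
  | .inl i => x i
  | .inr m => (C.wireVals x).getD m false

/-- The size of a circuit: its number of gates (Arora–Barak 2009, Def. 6.1). [cite: AroraBarak2009, Def. 6.1] -/
def size (C : Circuit ι) : ℕ := C.gates.length

/-- Weighted size: the sum of `w g.fn` over all gates `g` (e.g. `w = 0` on negations counts only
`∧`/`∨` gates; Jukna 2012, §1.2). [cite: Jukna2012, §1.2] -/
def sizeWith (C : Circuit ι) (w : GateFn → ℕ) : ℕ := (C.gates.map fun g => w g.fn).sum

/-- The list of weighted depths of all gates of `C`: the depth of gate `g` is `w g.fn` plus the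
maximum depth of its argument wires (inputs have depth `0`) (Vollmer 1999, §1.2). [cite: Vollmer1999, §1.2] -/
def depthVals (C : Circuit ι) (w : GateFn → ℕ) : List ℕ :=
  C.gates.foldl (fun ds g => ds ++
    [w g.fn + univ.sup fun a => match g.args a with
      | .inl _ => 0
      | .inr m => ds.getD m 0]) []

/-- Weighted depth: the maximum over paths from an input to the output of the total weight of the
gates on the path (Vollmer 1999, §1.2; with `w = acWeight` negations are free). [cite: Vollmer1999, §1.2] -/
def depthWith (C : Circuit ι) (w : GateFn → ℕ) : ℕ :=
  match C.output with
  | .inl _ => 0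
  | .inr m => (C.depthVals w).getD m 0

/-- The depth of a circuit: the length of a longest input–output path, every gate counting `1`
(Arora–Barak 2009, Def. 6.1). [cite: AroraBarak2009, Def. 6.1] -/
def depth (C : Circuit ι) : ℕ := C.depthWith fun _ => 1

/-- The maximum fan-in of a gate of `C` (`0` for a circuit without gates) (Vollmer 1999, §1.1). [cite: Vollmer1999, §1.1] -/
def maxFanIn (C : Circuit ι) : ℕ := (C.gates.map Gate.arity).foldr max 0

/-- `C.IsOver B`: every gate of `C` is drawn from the basis `B` (Vollmer 1999, Def. 1.6). [cite: Vollmer1999, Def. 1.6] -/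
def IsOver (C : Circuit ι) (B : Set GateFn) : Prop := ∀ g ∈ C.gates, g.fn ∈ B

/-- The number of argument positions (over all gates) wired to gate `m`, i.e. the fan-out of gate
`m` inside the program (the output wire is not counted) (Jukna 2012, §1.2). [cite: Jukna2012, §1.2] -/
def refCount (C : Circuit ι) (m : ℕ) : ℕ :=
  (C.gates.map fun g => (univ.filter fun a : Fin g.arity => (g.args a).getRight? = some m).card).sum

/-- A circuit is a *formula* if every gate is used as an argument at most once, i.e. the
underlying DAG restricted to gates is a forest (Jukna 2012, §1.2). [cite: Jukna2012, §1.2] -/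
def IsFormula (C : Circuit ι) : Prop := ∀ m, C.refCount m ≤ 1

/-- `C.Computes f`: the circuit `C` computes the Boolean function `f` (Arora–Barak 2009,
Def. 6.1). [cite: AroraBarak2009, Def. 6.1] -/
def Computes (C : Circuit ι) (f : (ι → Bool) → Bool) : Prop := ∀ x, C.eval x = f x

/-- The gate-free circuit whose output is the input variable `i` (Vollmer 1999, §1.1,
projections). [cite: Vollmer1999, §1.1  projections] -/
def input (i : ι) : Circuit ι where
  gates := []
  output := .inl i
  wf j h := absurd h (Nat.not_lt_zero j)
  wf_output _ h := absurd h Sum.inl_ne_inr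

/-- The input circuit `input i` computes the projection `x ↦ x i` (Vollmer 1999, §1.1). [cite: Vollmer1999, §1.1] -/
@[simp] theorem eval_input (i : ι) (x : ι → Bool) : (input i).eval x = x i := rfl

/-- The input circuit has no gates (Vollmer 1999, §1.1). [cite: Vollmer1999, §1.1] -/
@[simp] theorem size_input (i : ι) : (input i : Circuit ι).size = 0 := rfl

/-- A circuit over a basis is a circuit over any larger basis (Vollmer 1999, §1.2). [cite: Vollmer1999, §1.2] -/
theorem IsOver.mono {C : Circuit ι} {B B' : Set GateFn} (h : C.IsOver B) (hBB' : B ⊆ B') :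
    C.IsOver B' := fun g hg => hBB' (h g hg)

/-- Over an empty variable set the input circuit does not exist, but constant gates do: the
circuit with the single gate `const b` (Vollmer 1999, §1.1). [cite: Vollmer1999, §1.1] -/
def const (ι : Type*) (b : Bool) : Circuit ι where
  gates := [⟨0, fun _ => b, Fin.elim0⟩]
  output := .inr 0
  wf j h a := by
    simp only [List.length_singleton, Nat.lt_one_iff] at h
    subst h
    exact a.elim0
  wf_output m h := by cases h; simp

/-- The constant circuit computes the constant `b` (Vollmer 1999, §1.1). [cite: Vollmer1999, §1.1] -/
@[simp] theorem eval_const (b : Bool) (x : ι → Bool) : (const ι b).eval x = b := rfl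

/-- The constant circuit has exactly one gate (Vollmer 1999, §1.1). [cite: Vollmer1999, §1.1] -/
@[simp] theorem size_const (b : Bool) : (const ι b).size = 1 := rfl

end Circuit

/-! ### Circuit and formula complexity of a Boolean function -/

/-- Every Boolean function on finitely many (and at least one) variables is computed by a
circuit over the De Morgan basis `{∧₂, ∨₂, ¬}` (e.g. via its DNF; constants as `x ∧ ¬x`,
`x ∨ ¬x`) (Jukna 2012, §1.1; Arora–Barak 2009, Claim 2.13). [cite: Jukna2012, §1.1] -/
def exists_computes_deMorgan : Prop :=
  ∀ {ι : Type*} [Fintype ι] [Nonempty ι] (f : (ι → Bool) → Bool),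
    ∃ C : Circuit ι, C.IsOver deMorganBasis ∧ C.Computes f

/-- The circuit complexity of `f` over the basis `B`: the least size of a circuit over `B`
computing `f` (Vollmer 1999, Def. 1.7; Jukna 2012, §1.2). **Junk value `0`** if no circuit over
`B` computes `f` — e.g. over `monotoneBasis` for every non-monotone or constant `f`; over
`deMorganBasis`/`B2` with `[Fintype ι] [Nonempty ι]` the infimum is attained
(`exists_computes_deMorgan`). Note also that projections `x ↦ x i` have complexity `0`
genuinely (`Circuit.input i`). [cite: Vollmer1999, Def. 1.7] -/
noncomputable def circuitSizeOver {ι : Type*} (B : Set GateFn) (f : (ι → Bool) → Bool) : ℕ :=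
  sInf {s | ∃ C : Circuit ι, C.IsOver B ∧ C.Computes f ∧ C.size = s}

/-- The formula complexity (leaf-size minus one, i.e. number of gates of a formula) of `f` over
the basis `B` (Jukna 2012, §1.2). **Junk value `0`** if no formula over `B` computes `f`
(same caveats as `circuitSizeOver`). [cite: Jukna2012, §1.2] -/
noncomputable def formulaSizeOver {ι : Type*} (B : Set GateFn) (f : (ι → Bool) → Bool) : ℕ :=
  sInf {s | ∃ C : Circuit ι, C.IsOver B ∧ C.IsFormula ∧ C.Computes f ∧ C.size = s}

/-- Any circuit over `B` computing `f` bounds the circuit complexity of `f` over `B`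
(Vollmer 1999, Def. 1.7). [cite: Vollmer1999, Def. 1.7] -/
theorem circuitSizeOver_le_of_computes {ι : Type*} {B : Set GateFn} {f : (ι → Bool) → Bool}
    (C : Circuit ι) (hB : C.IsOver B) (hf : C.Computes f) : circuitSizeOver B f ≤ C.size :=
  Nat.sInf_le ⟨C, hB, hf, rfl⟩

/-- Any formula over `B` computing `f` bounds the formula complexity of `f` over `B`
(Jukna 2012, §1.2). [cite: Jukna2012, §1.2] -/
theorem formulaSizeOver_le_of_computes {ι : Type*} {B : Set GateFn} {f : (ι → Bool) → Bool}
    (C : Circuit ι) (hB : C.IsOver B) (hF : C.IsFormula) (hf : C.Computes f) :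
    formulaSizeOver B f ≤ C.size :=
  Nat.sInf_le ⟨C, hB, hF, hf, rfl⟩

/-- Circuit complexity is antitone in the basis, provided some circuit over the smaller basis
computes `f` (otherwise the left-hand side is the junk value `0`) (Vollmer 1999, §1.2). [cite: Vollmer1999, §1.2] -/
def circuitSizeOver_mono : Prop :=
  ∀ {ι : Type*} {B B' : Set GateFn} (hBB' : B ⊆ B') {f : (ι → Bool) → Bool} (h : ∃ C : Circuit ι, C.IsOver B ∧ C.Computes f),
    circuitSizeOver B' f ≤ circuitSizeOver B f

end Literature.Computability.Complexity
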